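import Summits.KontsevichZagierPeriods.KontsevichZagierPeriods.Theorems.HyperbolicBlochOffTetraSectorKernelStubRaySplitAux

/-!
# OffTetraSectorKernel (stmt-KontsevichZagierPeriods-10557), line odd-hyperbolic-ladder: stub `stub_raySplit`

`[Ray₁(a,b,r)] − [Band₁(a,b)] + [C(a,b) × Λ±(r)] ∈ KZ.relations`: the fibrewise logarithm identity
`log(s r) = −log(1/s) + log r`, read two-sheetedly, is a chain of Kontsevich–Zagier moves on
two-dimensional representations `[σ, F]` with the kernel
`F(s, v) = b / (((1 − s a)² + (s b)²) v) = g(s)/v`, `g(s) = Im (z/(1 − s z))`, `z = a + i b`.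

Coordinates `w = (s, v)`, base `0 < s < 1`. The three given representations are
`Ray₁ = [{v strictly between 1 and s r}, sgn(v − 1)·(−g(s))/v]`,
`Band₁ = [{1 ≤ v ≤ 1/s}, g(s)/v]` and `P = C × Λ± = [{v strictly between 1 and r}, sgn(v − 1)·g(s)/v]`.
The chain (`raySplit_core`):
1. rule (1a): split `Ray₁` and `P` along the sheets `v > 1` / `v < 1`;
2. rule (1a): close the fibres of the four sheets (null graphs), flipping the sign of the two sheets
   carrying `−F`, which gives `Xp = [{1 < s r, 1 ≤ v ≤ s r}, F] ≡ −Ray₁⁺`,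
   `Xm = [{s r < 1, s r ≤ v ≤ 1}, F] ≡ Ray₁⁻`, `Yp = [{1 ≤ v ≤ r}, F] ≡ P⁺`, `Ym = [{r ≤ v ≤ 1}, F] ≡ −P⁻`;
3. rule (2): the fibrewise dilation `v ↦ s v` (`dv/v` is invariant) identifies
   `Xp ∼ Np = [{1 < s r, 1/s ≤ v ≤ r}, F]` and `Xm ∼ Am = [{s r < 1, r ≤ v ≤ 1/s}, F]`
   (`raySplit_affine`, an instance of `KZ.of_sub_of_mem_relations_of_affine`);
4. rule (1a): `Am + Yp` and `(Band₁ + Np) + Ym` are two decompositions, with null overlaps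
   `{v = r}`, `{v = 1/s}`, `{v = 1}`, of one and the same region (`raySplit_regions`).
Summing up, `Ray₁ ≡ −Np + Am`, `P ≡ Yp − Ym` and `Am + Yp ≡ Band₁ + Np + Ym`, whence
`Ray₁ − Band₁ + P ≡ 0`. The hypothesis `r² = a² + b²` of the stub is not used (`r > 0` suffices).

References: M. Kontsevich, D. Zagier, *Periods* (2001), §1.1 (`log` as `∫ dv/v`), §1.2 rules (1), (2).
-/

noncomputable section

open Set MeasureTheory
open Literature.NumberTheory.Transcendental Literature.ModelTheory.ExponentialFields

namespace Summit.KontsevichZagierPeriods.HyperbolicBloch.OffTetraSectorKernel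

/-! ### The chain of moves -/

/-- **`[Ray₁] − [Band₁] + [P] ∈ relations`** (`log(s r) = −log(1/s) + log r` two-sheetedly), with
the kernel `F(s, v) = b/(((1 − s a)² + (s b)²) v)` abstracted. Chain of Kontsevich–Zagier moves:
(1a) split `Ray₁` and `P` along the sheets `v > 1` / `v < 1`; (1a) close the fibres of the four
sheets, flipping the sign of the `v > 1` sheet of `Ray₁` and of the `v < 1` sheet of `P`, to get
`Xp = [{1 < s r, 1 ≤ v ≤ s r}, F]`, `Xm = [{s r < 1, s r ≤ v ≤ 1}, F]`, `Yp = [{1 ≤ v ≤ r}, F]`,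
`Ym = [{r ≤ v ≤ 1}, F]`; (2) the dilation `v ↦ s v` identifies `Xp ∼ Np = [{1 < s r, 1/s ≤ v ≤ r}, F]`
and `Xm ∼ Am = [{s r < 1, r ≤ v ≤ 1/s}, F]`; (1a) finally `Am + Yp` and `(Band₁ + Np) + Ym` are two
decompositions (null overlaps `v = r`, `v = 1/s`, `v = 1`) of one and the same region
(`raySplit_regions`). [cite: KontsevichZagier2001, §1.2] -/
theorem raySplit_core {a b r : ℝ} (ha : IsAlgebraic ℚ a) (hb : IsAlgebraic ℚ b)
    (hr : IsAlgebraic ℚ r) (hb0 : 0 < b) (hr0 : 0 < r) (F : (Fin 2 → ℝ) → ℝ)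
    (hF : ∀ w, F w = b / ((1 - w 0 * a) ^ 2 + (w 0 * b) ^ 2) / w 1)
    (R₁ B P : KZ.IntegralRep 2)
    (hR₁ : R₁.domain =
      {w | (0 < w 0 ∧ w 0 < 1) ∧ ((1 < w 1 ∧ w 1 < w 0 * r) ∨ (w 0 * r < w 1 ∧ w 1 < 1))})
    (hR₁i : EqOn R₁.integrand (fun w => (if 1 < w 1 then (1 : ℝ) else -1) * (-b) /
      (w 1 * ((1 - w 0 * a) ^ 2 + (w 0 * b) ^ 2))) R₁.domain)
    (hB : B.domain = {w | (0 < w 0 ∧ w 0 < 1) ∧ 1 ≤ w 1 ∧ w 1 ≤ 1 / w 0})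
    (hBi : EqOn B.integrand F B.domain)
    (hP : P.domain = {w | (0 < w 0 ∧ w 0 < 1) ∧ ((1 < w 1 ∧ w 1 < r) ∨ (r < w 1 ∧ w 1 < 1))})
    (hPi : EqOn P.integrand (fun w => b / ((1 - w 0 * a) ^ 2 + (w 0 * b) ^ 2) *
      ((if 1 < w 1 then (1 : ℝ) else -1) / w 1)) P.domain) :
    KZ.of R₁ - KZ.of B + KZ.of P ∈ KZ.relations := by
  -- coordinates `w = (s, v)`: `w 0 = Fin.init w 0`, `w 1 = w (Fin.last 1)`
  have hinit : ∀ w : Fin 2 → ℝ, Fin.init w 0 = w 0 := fun _ => rfl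
  have hlast : (Fin.last 1 : Fin 2) = 1 := rfl
  -- semialgebraic data
  have hσ : IsSemialgebraic ℚ {x : Fin 1 → ℝ | 0 < x 0 ∧ x 0 < 1} :=
    isSemialgebraic_unitInterval_fin_one
  have hFT : IsSemialgebraicFunOn ℚ {w : Fin 2 → ℝ | 0 < w 1} F :=
    (raySplit_isSemialgebraicFunOn_kernel ha hb hb0.ne').congr fun w _ => (hF w).symm
  have hFon : ∀ {S : Set (Fin 2 → ℝ)}, IsSemialgebraic ℚ S → (∀ w ∈ S, 0 < w 1) →
      IsSemialgebraicFunOn ℚ S F := fun hS hpos => hFT.mono (fun w hw => hpos w hw) hS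
  obtain ⟨hLt, hGt⟩ := raySplit_isSemialgebraic_sheets
  -- the base pieces `Gp = {1 < s r}`, `Gm = {s r < 1}` of `(0, 1)`
  obtain ⟨Gp, hGp⟩ : ∃ G : Set (Fin 1 → ℝ), G = {x | (0 < x 0 ∧ x 0 < 1) ∧ 1 < x 0 * r} :=
    ⟨_, rfl⟩
  obtain ⟨Gm, hGm⟩ : ∃ G : Set (Fin 1 → ℝ), G = {x | (0 < x 0 ∧ x 0 < 1) ∧ x 0 * r < 1} :=
    ⟨_, rfl⟩
  have hGp2 : ∀ z : Fin 2 → ℝ, (Fin.init z : Fin 1 → ℝ) ∈ Gp ↔ (0 < z 0 ∧ z 0 < 1) ∧ 1 < z 0 * r :=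
    fun z => by rw [hGp]; exact Iff.rfl
  have hGm2 : ∀ z : Fin 2 → ℝ, (Fin.init z : Fin 1 → ℝ) ∈ Gm ↔ (0 < z 0 ∧ z 0 < 1) ∧ z 0 * r < 1 :=
    fun z => by rw [hGm]; exact Iff.rfl
  have hGp_sa : IsSemialgebraic ℚ Gp := by rw [hGp]; exact raySplit_isSemialgebraic_baseGt hr
  have hGm_sa : IsSemialgebraic ℚ Gm := by rw [hGm]; exact raySplit_isSemialgebraic_baseLt hr
  have hGppos : ∀ y ∈ Gp, 0 < y 0 := fun y hy => by rw [hGp] at hy; exact hy.1.1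
  have hGmpos : ∀ y ∈ Gm, 0 < y 0 := fun y hy => by rw [hGm] at hy; exact hy.1.1
  have hc0 : Continuous fun x : Fin 1 → ℝ => x 0 := continuous_apply 0
  have hGpo : IsOpen Gp := by
    rw [hGp]
    exact ((isOpen_lt continuous_const hc0).inter (isOpen_lt hc0 continuous_const)).inter
      (isOpen_lt continuous_const (hc0.mul continuous_const))
  have hGmo : IsOpen Gm := by
    rw [hGm]
    exact ((isOpen_lt continuous_const hc0).inter (isOpen_lt hc0 continuous_const)).inter
      (isOpen_lt (hc0.mul continuous_const) continuous_const)
  -- the edges `1`, `r`, `s r`, `1/s`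
  have h1σ : IsSemialgebraicFunOn ℚ {x : Fin 1 → ℝ | 0 < x 0 ∧ x 0 < 1} (fun _ => (1 : ℝ)) := by
    simpa using isSemialgebraicFunOn_ratCast hσ 1
  have hrσ : IsSemialgebraicFunOn ℚ {x : Fin 1 → ℝ | 0 < x 0 ∧ x 0 < 1} (fun _ => r) :=
    isSemialgebraicFunOn_const_of_isAlgebraic hσ hr
  have hinvσ : IsSemialgebraicFunOn ℚ {x : Fin 1 → ℝ | 0 < x 0 ∧ x 0 < 1} (fun x => 1 / x 0) :=
    raySplit_isSemialgebraicFunOn_inv hσ fun x hx => hx.1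
  have h1Gp : IsSemialgebraicFunOn ℚ Gp (fun _ => (1 : ℝ)) := by
    simpa using isSemialgebraicFunOn_ratCast hGp_sa 1
  have h1Gm : IsSemialgebraicFunOn ℚ Gm (fun _ => (1 : ℝ)) := by
    simpa using isSemialgebraicFunOn_ratCast hGm_sa 1
  have hrGp : IsSemialgebraicFunOn ℚ Gp (fun _ => r) :=
    isSemialgebraicFunOn_const_of_isAlgebraic hGp_sa hr
  have hrGm : IsSemialgebraicFunOn ℚ Gm (fun _ => r) :=
    isSemialgebraicFunOn_const_of_isAlgebraic hGm_sa hr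
  have hmulGp : IsSemialgebraicFunOn ℚ Gp (fun x => x 0 * r) :=
    raySplit_isSemialgebraicFunOn_mulConst hGp_sa hr
  have hmulGm : IsSemialgebraicFunOn ℚ Gm (fun x => x 0 * r) :=
    raySplit_isSemialgebraicFunOn_mulConst hGm_sa hr
  have hinvGp : IsSemialgebraicFunOn ℚ Gp (fun x => 1 / x 0) :=
    raySplit_isSemialgebraicFunOn_inv hGp_sa hGppos
  have hinvGm : IsSemialgebraicFunOn ℚ Gm (fun x => 1 / x 0) :=
    raySplit_isSemialgebraicFunOn_inv hGm_sa hGmpos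
  -- Step 1 (rule (1a)): split `R₁` and `P` along the sheets `v > 1` / `v < 1`
  obtain ⟨R₁p, hR₁pd, hR₁pi⟩ : ∃ R : KZ.IntegralRep 2,
      R.domain = R₁.domain ∩ {w | 1 < w 1} ∧ R.integrand = R₁.integrand :=
    ⟨R₁.restrict _ (R₁.isSemialgebraic_domain.inter hLt) inter_subset_left, rfl, rfl⟩
  obtain ⟨R₁m, hR₁md, hR₁mi⟩ : ∃ R : KZ.IntegralRep 2,
      R.domain = R₁.domain ∩ {w | w 1 < 1} ∧ R.integrand = R₁.integrand :=
    ⟨R₁.restrict _ (R₁.isSemialgebraic_domain.inter hGt) inter_subset_left, rfl, rfl⟩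
  obtain ⟨Pp, hPpd, hPpi⟩ : ∃ R : KZ.IntegralRep 2,
      R.domain = P.domain ∩ {w | 1 < w 1} ∧ R.integrand = P.integrand :=
    ⟨P.restrict _ (P.isSemialgebraic_domain.inter hLt) inter_subset_left, rfl, rfl⟩
  obtain ⟨Pm, hPmd, hPmi⟩ : ∃ R : KZ.IntegralRep 2,
      R.domain = P.domain ∩ {w | w 1 < 1} ∧ R.integrand = P.integrand :=
    ⟨P.restrict _ (P.isSemialgebraic_domain.inter hGt) inter_subset_left, rfl, rfl⟩
  have k1 : KZ.of R₁ - KZ.of R₁p - KZ.of R₁m ∈ KZ.relations := by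
    refine KZ.domainAddRel_subset_relations ⟨2, R₁, R₁p, R₁m, ?_, ?_,
      fun w _ => by rw [hR₁pi], fun w _ => by rw [hR₁mi], rfl⟩
    · rw [hR₁pd, hR₁md, ← inter_union_distrib_left]
      refine (inter_eq_left.2 fun w hw => ?_).symm
      rw [hR₁] at hw
      rcases hw.2 with h | h
      · exact Or.inl h.1
      · exact Or.inr h.2
    · rw [hR₁pd, hR₁md]
      exact measure_mono_null (fun w hw => absurd (lt_trans (show (1 : ℝ) < w 1 from hw.1.2)
        (show w 1 < 1 from hw.2.2)) (lt_irrefl _)) measure_empty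
  have k9 : KZ.of P - KZ.of Pp - KZ.of Pm ∈ KZ.relations := by
    refine KZ.domainAddRel_subset_relations ⟨2, P, Pp, Pm, ?_, ?_,
      fun w _ => by rw [hPpi], fun w _ => by rw [hPmi], rfl⟩
    · rw [hPpd, hPmd, ← inter_union_distrib_left]
      refine (inter_eq_left.2 fun w hw => ?_).symm
      rw [hP] at hw
      rcases hw.2 with h | h
      · exact Or.inl h.1
      · exact Or.inr h.2
    · rw [hPpd, hPmd]
      exact measure_mono_null (fun w hw => absurd (lt_trans (show (1 : ℝ) < w 1 from hw.1.2)
        (show w 1 < 1 from hw.2.2)) (lt_irrefl _)) measure_empty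
  -- the negatives of the `v > 1` sheet of `R₁` and of the `v < 1` sheet of `P`
  obtain ⟨R₁n, hR₁nd, hR₁ni⟩ : ∃ R : KZ.IntegralRep 2,
      R.domain = R₁.domain ∩ {w | 1 < w 1} ∧ R.integrand = -R₁.integrand :=
    ⟨R₁p.neg, by rw [KZ.IntegralRep.domain_neg, hR₁pd],
      by rw [KZ.IntegralRep.integrand_neg, hR₁pi]⟩
  have k2n : KZ.of R₁p + KZ.of R₁n ∈ KZ.relations :=
    KZ.of_add_of_mem_relations_of_eqOn_neg (by rw [hR₁nd, hR₁pd]) fun w _ => by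
      rw [hR₁ni, hR₁pi]
  obtain ⟨Pn, hPnd, hPni⟩ : ∃ R : KZ.IntegralRep 2,
      R.domain = P.domain ∩ {w | w 1 < 1} ∧ R.integrand = -P.integrand :=
    ⟨Pm.neg, by rw [KZ.IntegralRep.domain_neg, hPmd],
      by rw [KZ.IntegralRep.integrand_neg, hPmi]⟩
  have k8n : KZ.of Pm + KZ.of Pn ∈ KZ.relations :=
    KZ.of_add_of_mem_relations_of_eqOn_neg (by rw [hPnd, hPmd]) fun w _ => by
      rw [hPni, hPmi]
  -- Step 2 (rule (1a)): close the fibres; all four closed sheets carry the kernel `F`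
  obtain ⟨Xp, hXpd, hXpi, k2⟩ := raySplit_closedBand R₁n h1Gp hmulGp
    (hFon (KZlog.isSemialgebraic_band h1Gp hmulGp) fun w hw => one_pos.trans_le hw.2.1)
    (by
      rw [hR₁nd, hR₁]
      ext z
      simp only [mem_inter_iff, mem_setOf_eq, hGp2, hinit, hlast]
      constructor
      · rintro ⟨⟨hs, h | h⟩, h1⟩
        · exact ⟨⟨hs, h1.trans h.2⟩, h.1, h.2⟩
        · exact absurd (h1.trans h.2) (lt_irrefl _)
      · rintro ⟨⟨hs, -⟩, h1, h2⟩
        exact ⟨⟨hs, Or.inl ⟨h1, h2⟩⟩, h1⟩)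
    (fun w hw => by
      rw [hR₁nd] at hw
      rw [hR₁ni, Pi.neg_apply, hR₁i hw.1]
      beta_reduce
      rw [if_pos (show 1 < w 1 from hw.2), hF, div_div,
        mul_comm ((1 - w 0 * a) ^ 2 + (w 0 * b) ^ 2) (w 1)]
      ring)
  obtain ⟨Xm, hXmd, hXmi, k3⟩ := raySplit_closedBand R₁m hmulGm h1Gm
    (hFon (KZlog.isSemialgebraic_band hmulGm h1Gm) fun w hw =>
      (mul_pos (hGmpos _ hw.1) hr0).trans_le hw.2.1)
    (by
      rw [hR₁md, hR₁]
      ext z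
      simp only [mem_inter_iff, mem_setOf_eq, hGm2, hinit, hlast]
      constructor
      · rintro ⟨⟨hs, h | h⟩, h1⟩
        · exact absurd (h.1.trans h1) (lt_irrefl _)
        · exact ⟨⟨hs, h.1.trans h.2⟩, h.1, h.2⟩
      · rintro ⟨⟨hs, -⟩, h1, h2⟩
        exact ⟨⟨hs, Or.inr ⟨h1, h2⟩⟩, h2⟩)
    (fun w hw => by
      rw [hR₁md] at hw
      rw [hR₁mi, hR₁i hw.1]
      beta_reduce
      rw [if_neg (not_lt.2 (le_of_lt (show w 1 < 1 from hw.2))), hF, div_div,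
        mul_comm ((1 - w 0 * a) ^ 2 + (w 0 * b) ^ 2) (w 1)]
      ring)
  obtain ⟨Yp, hYpd, hYpi, k7⟩ := raySplit_closedBand Pp h1σ hrσ
    (hFon (KZlog.isSemialgebraic_band h1σ hrσ) fun w hw => one_pos.trans_le hw.2.1)
    (by
      rw [hPpd, hP]
      ext z
      simp only [mem_inter_iff, mem_setOf_eq, hinit, hlast]
      constructor
      · rintro ⟨⟨hs, h | h⟩, h1⟩
        · exact ⟨hs, h.1, h.2⟩
        · exact absurd (h1.trans h.2) (lt_irrefl _)
      · rintro ⟨hs, h1, h2⟩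
        exact ⟨⟨hs, Or.inl ⟨h1, h2⟩⟩, h1⟩)
    (fun w hw => by
      rw [hPpd] at hw
      rw [hPpi, hPi hw.1]
      beta_reduce
      rw [if_pos (show 1 < w 1 from hw.2), hF]
      ring)
  obtain ⟨Ym, hYmd, hYmi, k8⟩ := raySplit_closedBand Pn hrσ h1σ
    (hFon (KZlog.isSemialgebraic_band hrσ h1σ) fun w hw => hr0.trans_le hw.2.1)
    (by
      rw [hPnd, hP]
      ext z
      simp only [mem_inter_iff, mem_setOf_eq, hinit, hlast]
      constructor
      · rintro ⟨⟨hs, h | h⟩, h1⟩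
        · exact absurd (h.1.trans h1) (lt_irrefl _)
        · exact ⟨hs, h.1, h.2⟩
      · rintro ⟨hs, h1, h2⟩
        exact ⟨⟨hs, Or.inr ⟨h1, h2⟩⟩, h2⟩)
    (fun w hw => by
      rw [hPnd] at hw
      rw [hPni, Pi.neg_apply, hPi hw.1]
      beta_reduce
      rw [if_neg (not_lt.2 (le_of_lt (show w 1 < 1 from hw.2))), hF]
      ring)
  -- Step 3 (rule (2)): the dilation `v ↦ s v` identifies `Np ∼ Xp` over `Gp` and `Am ∼ Xm` over `Gm`
  have hNpsub : KZlog.band Gp (fun x => 1 / x 0) (fun _ => r) ⊆ Yp.domain := by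
    rw [hYpd]
    intro z hz
    have hs := (hGp2 z).1 hz.1
    exact ⟨hs.1, (one_lt_one_div hs.1.1 hs.1.2).le.trans hz.2.1, hz.2.2⟩
  obtain ⟨Np, hNpd, hNpi⟩ : ∃ N : KZ.IntegralRep 2,
      N.domain = KZlog.band Gp (fun x => 1 / x 0) (fun _ => r) ∧ N.integrand = F :=
    ⟨Yp.restrict _ (KZlog.isSemialgebraic_band hinvGp hrGp) hNpsub, rfl, hYpi⟩
  have hBF : IntegrableOn F B.domain :=
    B.integrableOn.congr_fun hBi (KZ.IntegralRep.measurableSet_domain_holds B)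
  have hYmF : IntegrableOn F Ym.domain := by rw [← hYmi]; exact Ym.integrableOn
  have hAm_sa : IsSemialgebraic ℚ (KZlog.band Gm (fun _ => r) (fun x => 1 / x 0)) :=
    KZlog.isSemialgebraic_band hrGm hinvGm
  have hAm_int : IntegrableOn F (KZlog.band Gm (fun _ => r) (fun x => 1 / x 0)) := by
    refine (hBF.union hYmF).mono_set fun z hz => ?_
    have hs := (hGm2 z).1 hz.1
    rcases le_total 1 (z 1) with h | h
    · left
      rw [hB]
      exact ⟨hs.1, h, hz.2.2⟩
    · right
      rw [hYmd]
      exact ⟨hs.1, hz.2.1, h⟩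
  obtain ⟨Am, hAmd, hAmi⟩ : ∃ A : KZ.IntegralRep 2,
      A.domain = KZlog.band Gm (fun _ => r) (fun x => 1 / x 0) ∧ A.integrand = F :=
    ⟨⟨_, F, hAm_sa, hFon hAm_sa fun w hw => hr0.trans_le hw.2.1, hAm_int⟩, rfl, rfl⟩
  have k4 : KZ.of Np - KZ.of Xp ∈ KZ.relations :=
    raySplit_affine F hF hGpo hGp_sa hGppos (lo := fun x => 1 / x 0) (hi := fun _ => r)
      (lo' := fun _ => 1) (hi' := fun x => x 0 * r)
      (fun y hy => (mul_one_div_cancel (hGppos y hy).ne').symm) (fun _ _ => rfl)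
      Np Xp hNpd hNpi hXpd hXpi
  have k5 : KZ.of Am - KZ.of Xm ∈ KZ.relations :=
    raySplit_affine F hF hGmo hGm_sa hGmpos (lo := fun _ => r) (hi := fun x => 1 / x 0)
      (lo' := fun x => x 0 * r) (hi' := fun _ => 1)
      (fun _ _ => rfl) (fun y hy => (mul_one_div_cancel (hGmpos y hy).ne').symm)
      Am Xm hAmd hAmi hXmd hXmi
  -- Step 4 (rule (1a)): `Am + Yp` and `(B + Np) + Ym` decompose one and the same region
  have hYpF : IntegrableOn F Yp.domain := by rw [← hYpi]; exact Yp.integrableOn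
  have hAmF : IntegrableOn F Am.domain := by rw [← hAmi]; exact Am.integrableOn
  have hNpF : IntegrableOn F Np.domain := by rw [← hNpi]; exact Np.integrableOn
  have hposAm : ∀ w ∈ Am.domain, 0 < w 1 := fun w hw => by
    rw [hAmd] at hw; exact hr0.trans_le hw.2.1
  have hposYp : ∀ w ∈ Yp.domain, 0 < w 1 := fun w hw => by
    rw [hYpd] at hw; exact one_pos.trans_le hw.2.1
  have hposB : ∀ w ∈ B.domain, 0 < w 1 := fun w hw => by
    rw [hB] at hw; exact one_pos.trans_le hw.2.1
  have hposNp : ∀ w ∈ Np.domain, 0 < w 1 := fun w hw => by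
    rw [hNpd] at hw; exact (one_div_pos.2 (hGppos _ hw.1)).trans_le hw.2.1
  have hposYm : ∀ w ∈ Ym.domain, 0 < w 1 := fun w hw => by
    rw [hYmd] at hw; exact hr0.trans_le hw.2.1
  obtain ⟨U, hUd, hUi⟩ : ∃ U : KZ.IntegralRep 2,
      U.domain = Am.domain ∪ Yp.domain ∧ U.integrand = F :=
    ⟨⟨_, F, Am.isSemialgebraic_domain.union Yp.isSemialgebraic_domain,
      hFon (Am.isSemialgebraic_domain.union Yp.isSemialgebraic_domain) fun w hw =>
        hw.elim (hposAm w) (hposYp w), hAmF.union hYpF⟩, rfl, rfl⟩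
  obtain ⟨U', hU'd, hU'i⟩ : ∃ U : KZ.IntegralRep 2,
      U.domain = B.domain ∪ Np.domain ∧ U.integrand = F :=
    ⟨⟨_, F, B.isSemialgebraic_domain.union Np.isSemialgebraic_domain,
      hFon (B.isSemialgebraic_domain.union Np.isSemialgebraic_domain) fun w hw =>
        hw.elim (hposB w) (hposNp w), hBF.union hNpF⟩, rfl, rfl⟩
  have hposU' : ∀ w ∈ U'.domain, 0 < w 1 := fun w hw => by
    rw [hU'd] at hw; exact hw.elim (hposB w) (hposNp w)
  have hU'F : IntegrableOn F U'.domain := by rw [← hU'i]; exact U'.integrableOn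
  obtain ⟨U'', hU''d, hU''i⟩ : ∃ U : KZ.IntegralRep 2,
      U.domain = U'.domain ∪ Ym.domain ∧ U.integrand = F :=
    ⟨⟨_, F, U'.isSemialgebraic_domain.union Ym.isSemialgebraic_domain,
      hFon (U'.isSemialgebraic_domain.union Ym.isSemialgebraic_domain) fun w hw =>
        hw.elim (hposU' w) (hposYm w), hU'F.union hYmF⟩, rfl, rfl⟩
  have k11 : KZ.of U - KZ.of Am - KZ.of Yp ∈ KZ.relations := by
    refine KZ.domainAddRel_subset_relations ⟨2, U, Am, Yp, hUd, ?_,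
      fun w _ => by rw [hUi, hAmi], fun w _ => by rw [hUi, hYpi], rfl⟩
    rw [hAmd, hYpd]
    exact measure_mono_null (fun z hz => le_antisymm hz.2.2.2 hz.1.2.1)
      (KZ.volume_setOf_last_eq_zero (n := 1) r)
  have k12 : KZ.of U' - KZ.of B - KZ.of Np ∈ KZ.relations := by
    refine KZ.domainAddRel_subset_relations ⟨2, U', B, Np, hU'd, ?_,
      fun w hw => by rw [hU'i]; exact (hBi hw).symm, fun w _ => by rw [hU'i, hNpi], rfl⟩
    rw [hB, hNpd]
    refine measure_mono_null (fun z hz => ?_) (KZ.volume_graph_eq_zero hinvσ)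
    exact ⟨hz.1.1, le_antisymm hz.1.2.2 hz.2.2.1⟩
  have k13 : KZ.of U'' - KZ.of U' - KZ.of Ym ∈ KZ.relations := by
    refine KZ.domainAddRel_subset_relations ⟨2, U'', U', Ym, hU''d, ?_,
      fun w _ => by rw [hU''i, hU'i], fun w _ => by rw [hU''i, hYmi], rfl⟩
    rw [hU'd, hB, hNpd, hYmd]
    refine measure_mono_null (fun z hz => ?_) (KZ.volume_setOf_last_eq_zero (n := 1) 1)
    rcases hz.1 with h | h
    · exact le_antisymm hz.2.2.2 h.2.1
    · have hs := (hGp2 z).1 h.1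
      exact absurd ((one_lt_one_div hs.1.1 hs.1.2).trans_le (h.2.1.trans hz.2.2.2))
        (lt_irrefl _)
  have k14 : KZ.of U'' - KZ.of U ∈ KZ.relations := by
    refine KZ.of_sub_of_mem_relations_of_eqOn ?_ fun w _ => by rw [hU''i, hUi]
    rw [hUd, hU''d, hU'd, hAmd, hYpd, hB, hNpd, hYmd, hGm, hGp]
    exact raySplit_regions hr0
  -- bookkeeping
  have : KZ.of R₁ - KZ.of B + KZ.of P =
      (KZ.of R₁ - KZ.of R₁p - KZ.of R₁m) + (KZ.of R₁p + KZ.of R₁n) + (KZ.of Np - KZ.of Xp)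
      + (KZ.of Xp - KZ.of R₁n) - (KZ.of Am - KZ.of Xm) - (KZ.of Xm - KZ.of R₁m)
      + (KZ.of P - KZ.of Pp - KZ.of Pm) - (KZ.of Yp - KZ.of Pp) + (KZ.of Pm + KZ.of Pn)
      + (KZ.of Ym - KZ.of Pn) - (KZ.of U'' - KZ.of U) - (KZ.of U - KZ.of Am - KZ.of Yp)
      + (KZ.of U' - KZ.of B - KZ.of Np) + (KZ.of U'' - KZ.of U' - KZ.of Ym) := by
    abel
  rw [this]
  exact KZ.relations.add_mem (KZ.relations.add_mem (KZ.relations.sub_mem (KZ.relations.sub_mem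
    (KZ.relations.add_mem (KZ.relations.add_mem (KZ.relations.sub_mem (KZ.relations.add_mem
    (KZ.relations.sub_mem (KZ.relations.sub_mem (KZ.relations.add_mem (KZ.relations.add_mem
    (KZ.relations.add_mem k1 k2n) k4) k2) k5) k3) k9) k7) k8n) k8) k14) k11) k12) k13

/-- STUB `stub_raySplit` (rules (1a), (2): `log(s r) = −log(1/s) + log r` two-sheetedly): the ray
representation after `u ↦ √u` splits as `[Ray₁(a,b,r)] ≡ [Band₁(a,b)] − [C(a,b) × Λ±(r)]`. The
chain of moves is `raySplit_core`: split both `Ray₁` and `P = C × Λ±(r)` along the sheets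
`v ≷ 1`, close the fibres, carry the two sheets of `Ray₁` by the fibrewise dilation `v ↦ s v`
(`KZ.of_sub_of_mem_relations_of_affine`) to bands with fibres `[1/s, r]` (over `s r > 1`) and
`[r, 1/s]` (over `s r < 1`), and recombine by domain additivity with `Band₁ = [{1 ≤ v ≤ 1/s}, g/v]`
and the two closed sheets `{1 ≤ v ≤ r}`, `{r ≤ v ≤ 1}` of `P`. (The hypothesis `r² = a² + b²` is
not needed: the identity holds for every `r > 0`.) [cite: KontsevichZagier2001, §1.2] -/
theorem stub_raySplit :
    ∀ (a b r : ℝ), IsAlgebraic ℚ a → IsAlgebraic ℚ b → IsAlgebraic ℚ r → 0 < b → 0 < r →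
    r ^ 2 = a ^ 2 + b ^ 2 →
    ∀ (R₁ B P : KZ.IntegralRep 2),
      R₁.domain = {w | (0 < w 0 ∧ w 0 < 1) ∧
        ((1 < w 1 ∧ w 1 < w 0 * r) ∨ (w 0 * r < w 1 ∧ w 1 < 1))} →
      Set.EqOn R₁.integrand
        (fun w => (if 1 < w 1 then (1 : ℝ) else -1) * (-b) /
          (w 1 * ((1 - w 0 * a) ^ 2 + (w 0 * b) ^ 2))) R₁.domain →
      B.domain = {w | (0 < w 0 ∧ w 0 < 1) ∧ 1 ≤ w 1 ∧ w 1 ≤ 1 / w 0} →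
      Set.EqOn B.integrand (fun w => b / ((1 - w 0 * a) ^ 2 + (w 0 * b) ^ 2) / w 1) B.domain →
      P.domain = {w | (0 < w 0 ∧ w 0 < 1) ∧ ((1 < w 1 ∧ w 1 < r) ∨ (r < w 1 ∧ w 1 < 1))} →
      Set.EqOn P.integrand
        (fun w => b / ((1 - w 0 * a) ^ 2 + (w 0 * b) ^ 2) *
          ((if 1 < w 1 then (1 : ℝ) else -1) / w 1)) P.domain →
      KZ.of R₁ - KZ.of B + KZ.of P ∈ KZ.relations := by
  intro a b r ha hb hr hb0 hr0 _ R₁ B P hR₁ hR₁i hB hBi hP hPi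
  exact raySplit_core ha hb hr hb0 hr0 _ (fun _ => rfl) R₁ B P hR₁ hR₁i hB hBi hP hPi

end Summit.KontsevichZagierPeriods.HyperbolicBloch.OffTetraSectorKernel

end
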